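import Summits.RiemannHypothesis.RiemannHypothesis.Theorems.Splittings.ZdReferencePins
import Literature.NumberTheory.LFunctions.LittlewoodOscillationInputsAverageProofs
import HarnessLib

/-!
# The exact-ratio reference (N64), shrinking windows and shrinking widths (zd-neg g9 §§4–6)

Cell rh-split, seat rh-split-zd-neg g9 (brief sha16 f79c5f09d8bcb036), card `run/shared/lean/pub/rh-split/cards/SPLIT-zd-neg.md` GEN-9
(N62–N64, B10); source `HOME/rh-split-zd-neg/SketchG9r3.lean` sha16 baf56696ec23d90d §§0–6 (= `SketchG9.lean` 1de7f68b shifted), referee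
rh-split-ref g4 REPLAY PASS 2026-08-27T07:55:17Z (rev.2) / 08:13:14Z (r3); lead rh-split-lead g3 lane (x-c), CARVE MAP in
`HOME/rh-split-zd-neg/HANDOFF-g9.md`.  Filed by rh-split-typer-2 g4 as three files (`ZdReferencePinsFrame` §§0–2 → `ZdReferencePins` §3 →
`ZdReferencePinsExact` §§4–6), namespace `RhSplitZdNegG9` ↦ `…Splittings.ZdReferencePins`; deltas per the CARVE MAP conventions: the scratch
abbreviations `FIN` / `H₀` are SPELLED OUT (`riemannHypothesisUpTo_platt_trudgian` / `3000175332800`) and dropped, decl text otherwise byte-verbatim;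
`RiemannHypothesis` is the summit's (`Summits.RiemannHypothesis.Statement`).

CONTENT (count side of the zd splitting search): «reference pins» — tails saying that the zero-counting jump `S(t) − S(t/2)` (or a windowed
version) stays small above a height — are VALID splitting partners of FIN in the trivial direction (§2) but are REFUTED: §3 (N63) by the local gap
engine modulo the tree-NAMED fact `buiMilinovich2018_theorem11_critical` (hypothesis position), §4 (N64) the exact-ratio reference only extracts a
dyadic companion, §5–§6 shrinking windows/widths (B10 scope).  The UNCONDITIONAL refutation of every pin containing the half-height point is E2
(`ZdTwoHeightMeanSquare.lean`).  LABELS (referee g4): RH-FREE kernel bookkeeping / refutations; class (zd, neg) UNCHANGED = BARRIER NOTE, 0 survivors.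

This file: §4 N64 (`DyadicExact`, `dyadicExact_companion`, `NoDyadicCompanion`, `rh_of_fin_of_dyadicExact_of_noCompanion`, `noDyadicCompanion_of_rh`), §5
`rh_of_fin_of_dyadicPin_logWidth`, §6 shrinking widths `c / log t` (`not_dyadicPinW_logWidth`).

Gate dedup delta: the one use of the scratch helper `log_two_pi_le_two` (private in `ZdReferencePins.lean`) cites the landed
`Literature.NumberTheory.LFunctions.LittlewoodAverage.log_two_pi_le_two` (module `LittlewoodOscillationInputsAverageProofs` imported).

HONEST LABEL: «SPLITTING SEARCH over kernel-typed RH-EQUIVALENCES; a splitting A ∧ B ⟹ RH is CONDITIONAL bookkeeping unless A and B are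
both proved; nothing here bears on the truth of RH.»
-/

set_option linter.dupNamespace false

noncomputable section

open Filter Complex
open scoped Real Topology

namespace Summit.RiemannHypothesis.RiemannHypothesis.Theorems.Splittings.ZdReferencePins

open Literature.NumberTheory.DiophantineGeometry Literature.NumberTheory.LFunctions
  Literature.Barriers.RiemannHypothesis

/-! ## §4 N64: the exact-ratio reference (width `0`) extracts only a dyadic companion -/

/-- `DyadicExact H`: `|S(t) − S(t/2)| < 1` for all `t ≥ H` (reference exactly at half height). -/
def DyadicExact (H : ℝ) : Prop :=
  ∀ t : ℝ, H ≤ t → |zetaArgS t - zetaArgS (t / 2)| < 1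

/-- If no zero of `ζ` has ordinate exactly `v > 0`… more precisely: if no zero has ordinate in
`(v − δ, v]`, then `N(v) = N(v − δ)`. -/
theorem count_eq_of_no_zero_in {v δ : ℝ} (hδ : 0 ≤ δ)
    (hno : ∀ ρ : ℂ, riemannZeta ρ = 0 → v - δ < ρ.im → ρ.im ≤ v → False) :
    (zetaZeroCount v : ℝ) = zetaZeroCount (v - δ) := by
  classical
  have hsum := zetaZeroCountRe_sub_eq_sum 0 (show v - δ ≤ v by linarith)
  have hzero : ∑ ρ ∈ (zetaZeroBox_finite 0 v).toFinset \ (zetaZeroBox_finite 0 (v - δ)).toFinset,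
      (riemannZetaZeroOrder ρ : ℝ) = 0 :=
    Finset.sum_eq_zero fun ρ hρ ↦ by
      obtain ⟨hz, -, -, h3, h4⟩ := mem_sdiff_zetaZeroBox hρ
      exact (hno ρ hz h3 h4).elim
  unfold zetaZeroCount
  have : ((zetaZeroCountRe 0 v : ℝ) - zetaZeroCountRe 0 (v - δ)) = 0 := by rw [hsum, hzero]
  linarith

/-- Left-isolation: if no zero of `ζ` has ordinate exactly `v > 0`, then for some `δ₁ > 0` no zero
has ordinate in `(v − δ₁, v]` (the zeros in the box below `v` are finitely many). -/
theorem exists_no_zero_below {v : ℝ} (hv0 : 0 < v) (hv : ∀ ρ : ℂ, riemannZeta ρ = 0 → ρ.im ≠ v) :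
    ∃ δ₁ : ℝ, 0 < δ₁ ∧ ∀ ρ : ℂ, riemannZeta ρ = 0 → v - δ₁ < ρ.im → ρ.im ≤ v → False := by
  classical
  by_cases hne : (zetaZeroBox_finite 0 v).toFinset.Nonempty
  · obtain ⟨ρ₀, hρ₀, hmax⟩ := (zetaZeroBox_finite 0 v).toFinset.exists_max_image Complex.im hne
    rw [Set.Finite.mem_toFinset] at hρ₀
    obtain ⟨hz₀, -, -, -, h4₀⟩ := hρ₀
    have hlt : ρ₀.im < v := lt_of_le_of_ne h4₀ (hv ρ₀ hz₀)
    refine ⟨min (v - ρ₀.im) v, lt_min (by linarith) hv0, fun ρ hz h3 h4 ↦ ?_⟩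
    have hρpos : 0 < ρ.im := by linarith [min_le_right (v - ρ₀.im) v]
    have hρmem : ρ ∈ (zetaZeroBox_finite 0 v).toFinset := by
      rw [Set.Finite.mem_toFinset]
      exact mem_zetaZeroBox_of_riemannZeta_eq_zero hz hρpos h4
    have h1 := hmax ρ hρmem
    linarith [min_le_left (v - ρ₀.im) v]
  · refine ⟨v, hv0, fun ρ hz h3 h4 ↦ hne ⟨ρ, ?_⟩⟩
    rw [Set.Finite.mem_toFinset]
    exact mem_zetaZeroBox_of_riemannZeta_eq_zero hz (by linarith) h4

/-- **N64 extracts only a dyadic companion.** `DyadicExact H` (`H ≥ 0`) forces every OFF-LINE zero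
`s` of `ζ` with `Im s > H` to have a zero of `ζ` at exactly half its ordinate. (So it is a splitting
partner of `riemannHypothesisUpTo_platt_trudgian` only together with an ordinate-independence statement excluding `γ = 2γ'`; by
itself the jump principle stalls at this companion configuration.) -/
theorem dyadicExact_companion {H : ℝ} (hH : 0 ≤ H) (h : DyadicExact H) {s : ℂ}
    (hs : riemannZeta s = 0) (hIm : H < s.im) (hre : s.re ≠ 1 / 2) :
    ∃ ρ : ℂ, riemannZeta ρ = 0 ∧ ρ.im = s.im / 2 := by
  by_contra hno
  push Not at hno
  have h0 : 0 < s.im := hH.trans_lt hIm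
  have him : s.im ≠ 0 := h0.ne'
  have hs' : riemannZeta (1 - starRingEnd ℂ s) = 0 := riemannZeta_one_sub_conj_eq_zero hs h0
  have him' : (1 - starRingEnd ℂ s).im = s.im := by simp
  have hres' : (1 - starRingEnd ℂ s).re = 1 - s.re := by simp
  have hne : s ≠ 1 - starRingEnd ℂ s := by
    intro hss
    apply hre
    have := congrArg Complex.re hss
    rw [hres'] at this
    linarith
  have hstrip := re_mem_Ioo_of_riemannZeta_eq_zero_of_im_ne_zero hs him
  -- left-isolation at `γ/2`
  obtain ⟨δ₁, hδ₁, hiso⟩ := exists_no_zero_below (v := s.im / 2) (by linarith) fun ρ hρ ↦ hno ρ hρ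
  -- margin at height `γ`
  have hSγ := (abs_lt.1 (h s.im hIm.le)).2
  obtain ⟨κ, hκ⟩ : ∃ κ : ℝ, κ = zetaArgS (s.im / 2) + 1 - zetaArgS s.im := ⟨_, rfl⟩
  have hκpos : 0 < κ := by linarith
  -- continuity of `θ` at `γ` and at `γ/2`
  obtain ⟨ε₀, hε₀, hθγ⟩ :=
    Metric.continuous_iff.1 continuous_riemannSiegelTheta s.im (π * κ / 2) (by positivity)
  obtain ⟨ε₁, hε₁, hθγ2⟩ :=
    Metric.continuous_iff.1 continuous_riemannSiegelTheta (s.im / 2) (π * κ / 2) (by positivity)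
  -- choose `δ` (the reference moves by `δ`, the height by `2δ`)
  obtain ⟨δ, hδpos, hδa, hδb, hδc, hδd⟩ : ∃ δ : ℝ, 0 < δ ∧ 2 * δ < ε₀ ∧ δ < ε₁ ∧ δ < δ₁ ∧
      H ≤ s.im - 2 * δ := by
    refine ⟨min (min (ε₀ / 4) (ε₁ / 2)) (min (δ₁ / 2) ((s.im - H) / 4)), ?_, ?_, ?_, ?_, ?_⟩
    · exact lt_min (lt_min (by linarith) (by linarith)) (lt_min (by linarith) (by linarith))
    · have := (min_le_left (min (ε₀ / 4) (ε₁ / 2)) (min (δ₁ / 2) ((s.im - H) / 4))).trans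
        (min_le_left (ε₀ / 4) (ε₁ / 2))
      linarith
    · have := (min_le_left (min (ε₀ / 4) (ε₁ / 2)) (min (δ₁ / 2) ((s.im - H) / 4))).trans
        (min_le_right (ε₀ / 4) (ε₁ / 2))
      linarith
    · have := (min_le_right (min (ε₀ / 4) (ε₁ / 2)) (min (δ₁ / 2) ((s.im - H) / 4))).trans
        (min_le_left (δ₁ / 2) ((s.im - H) / 4))
      linarith
    · have := (min_le_right (min (ε₀ / 4) (ε₁ / 2)) (min (δ₁ / 2) ((s.im - H) / 4))).trans
        (min_le_right (δ₁ / 2) ((s.im - H) / 4))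
      linarith
  -- at height `γ − 2δ`, reference `γ/2 − δ`: `S(γ − 2δ) − S(γ/2 − δ) > −1`
  have hSt := (abs_lt.1 (h (s.im - 2 * δ) hδd)).1
  rw [show (s.im - 2 * δ) / 2 = s.im / 2 - δ by ring] at hSt
  -- `N` at the reference does not move
  have hNref : (zetaZeroCount (s.im / 2) : ℝ) = zetaZeroCount (s.im / 2 - δ) :=
    count_eq_of_no_zero_in hδpos.le fun ρ hz h3 h4 ↦ hiso ρ hz (by linarith) h4
  -- the jump of `N` across `γ`
  have hjump := two_le_count_jump hs hs' hne him' h0 ⟨hstrip.1.le, hstrip.2.le⟩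
    ⟨by rw [hres']; linarith [hstrip.2], by rw [hres']; linarith [hstrip.1]⟩
    (t := s.im - 2 * δ) (by linarith)
  -- `θ` variations
  have hd1 : dist (s.im - 2 * δ) s.im < ε₀ := by
    rw [Real.dist_eq, show s.im - 2 * δ - s.im = -(2 * δ) by ring, abs_neg,
      abs_of_pos (by linarith)]
    exact hδa
  have hd2 : dist (s.im / 2 - δ) (s.im / 2) < ε₁ := by
    rw [Real.dist_eq, show s.im / 2 - δ - s.im / 2 = -δ by ring, abs_neg, abs_of_pos hδpos]
    exact hδb
  have hv1 := hθγ _ hd1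
  have hv2 := hθγ2 _ hd2
  rw [Real.dist_eq] at hv1 hv2
  have hv1' := (abs_lt.1 hv1).1
  have hv2' := (abs_lt.1 hv2).2
  have hX1 : (riemannSiegelTheta s.im - riemannSiegelTheta (s.im - 2 * δ)) / π < κ / 2 := by
    rw [div_lt_iff₀ Real.pi_pos]; linarith
  have hX2 : -(κ / 2) < (riemannSiegelTheta (s.im / 2) - riemannSiegelTheta (s.im / 2 - δ)) / π := by
    rw [lt_div_iff₀ Real.pi_pos]; linarith
  have key1 := zetaArgS_sub (s.im - 2 * δ) s.im
  have key2 := zetaArgS_sub (s.im / 2 - δ) (s.im / 2)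
  rw [hNref, sub_self, zero_sub] at key2
  linarith

/-- Hence, with `riemannHypothesisUpTo_platt_trudgian`, what N64 leaves is exactly: off-line zeros above `3000175332800` with dyadic companions.
Adding the ordinate statement `NoDyadicCompanion 3000175332800` closes the splitting. -/
def NoDyadicCompanion (H : ℝ) : Prop :=
  ∀ s ρ : ℂ, riemannZeta s = 0 → riemannZeta ρ = 0 → H < s.im → s.re ≠ 1 / 2 → ρ.im ≠ s.im / 2

/-- FIN ∧ DyadicExact ∧ NoDyadicCompanion ⟹ RH (the exact-ratio reference with its companion clause). -/
theorem rh_of_fin_of_dyadicExact_of_noCompanion (hA : riemannHypothesisUpTo_platt_trudgian) (hB : DyadicExact 3000175332800)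
    (hC : NoDyadicCompanion 3000175332800) : RiemannHypothesis := by
  refine rh_of_fin_of_rhAbove hA fun s hs hIm ↦ ?_
  by_contra hre
  obtain ⟨ρ, hρ, hρim⟩ := dyadicExact_companion (by norm_num) hB hs hIm hre
  exact hC s ρ hs hρ hIm hre hρim

/-- … and `NoDyadicCompanion` is RH-implied VACUOUSLY (no off-line zeros), so the three-piece
splitting `riemannHypothesisUpTo_platt_trudgian ∧ N64 ∧ NoDyadicCompanion → RH` has one immune conjunct; N64 itself is untouched by
both engines of this file (a dyadic reference defeats `Ω`, a width-`0` coupling defeats the gaps). -/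
theorem noDyadicCompanion_of_rh (hRH : RiemannHypothesis) {H : ℝ} (hH : 0 ≤ H) :
    NoDyadicCompanion H := fun s _ hs _ hIm hre _ ↦ hre (rhAbove_of_rh hRH hH s hs hIm)

/-! ## §5 The corner the engines of §3 do not reach: shrinking windows

A width that shrinks like `c / log t` is still a VALID splitting partner (antitone positive width on
`[3000175332800, ∞)`), but the gap engine needs a coupling length `2 w(t)` across which `θ/π` rises by `> 2r`,
i.e. `c > 2πr` (paper; §3 types constant widths), and Selberg's `Ω` theorem is defeated by any dyadic
reference. The corner `c ≤ 2πr`, `r ≤ 1` (and N64) is what the card banks. -/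

/-- Width `c / log t`: a valid splitting partner of `riemannHypothesisUpTo_platt_trudgian` for every `c > 0`, `r ≤ 1`. -/
theorem rh_of_fin_of_dyadicPin_logWidth {c r : ℝ} (hc : 0 < c) (hr : r ≤ 1) (hA : riemannHypothesisUpTo_platt_trudgian)
    (hB : DyadicPinW 3000175332800 r fun t ↦ c / Real.log t) : RiemannHypothesis := by
  have hlogpos : ∀ t : ℝ, 3000175332800 ≤ t → 0 < Real.log t := fun t ht ↦
    Real.log_pos (lt_of_lt_of_le (by norm_num) ht)
  refine rh_of_fin_of_rhAbove hA
    (rhAbove_of_dyadicPinW (by norm_num) hr ?_ (fun t ht ↦ div_pos hc (hlogpos t ht)) hB)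
  intro a ha b _ hab
  have ha' : 3000175332800 ≤ a := ha
  exact div_le_div_of_nonneg_left hc.le (hlogpos a ha')
    (Real.log_le_log (lt_of_lt_of_le (by norm_num) ha') hab)

/-! ## §6 Shrinking widths `c / log t` with `c > 2πr` still die (B10's scope clause in kernel)

Same engine as §3 with the coupling length `2w(t) = 2c/log t`: inside a critical gap the drop of
`S` across `min (2w(t)) (0.9·gap)` is `> 2r` as soon as `c > 2πr` (first case) — the second case
uses `r ≤ 1 < 0.9·3.18/2`. So the banked corner of the card is exactly `c ≤ 2πr`. -/

/-- Coupling for a variable width: `|S(t₁) − S(t₂)| < 2r` whenever `t₂ − t₁ ≤ 2 w(t₁)` and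
`w(t₂) ≥ 0` (common reference `t₂/2`). -/
theorem abs_sub_lt_of_dyadicPinW' {H r : ℝ} {w : ℝ → ℝ} (h : DyadicPinW H r w) {t₁ t₂ : ℝ}
    (h₁ : H ≤ t₁) (h₁₂ : t₁ ≤ t₂) (h₂ : t₂ ≤ t₁ + 2 * w t₁) (hw₂ : 0 ≤ w t₂) :
    |zetaArgS t₁ - zetaArgS t₂| < 2 * r := by
  have a := abs_lt.1 (h t₁ (t₂ / 2) h₁ (by linarith) (by linarith))
  have b := abs_lt.1 (h t₂ (t₂ / 2) (h₁.trans h₁₂) le_rfl (by linarith))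
  exact abs_lt.2 ⟨by linarith [a.1, b.2], by linarith [a.2, b.1]⟩

/-- **The gap engine for widths `c/log t`.** Under RH above `H`, radius `0 < r ≤ 1` and `c > 2πr`:
the pin `DyadicPinW H r (c/log ·)` fails (mod BM2018 Thm 1.1, first clause, unconditional). -/
theorem not_dyadicPinW_logWidth_of_rhAbove (hBM : buiMilinovich2018_theorem11_critical)
    {H c r : ℝ} (hr0 : 0 < r) (hr1 : r ≤ 1) (hc : 2 * π * r < c) (hRH : RHAbove H) :
    ¬ DyadicPinW H r fun t ↦ c / Real.log t := by
  intro hB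
  obtain ⟨c', hc', hgap⟩ := hBM
  have hπ3 : 3 < π := Real.pi_gt_three
  have hπ4 : π < 3.15 := Real.pi_lt_d2
  have hcr : 0 < c - 2 * π * r := by linarith
  have hπr : 0 < π * r := by positivity
  have hc0 : 0 < c := by linarith
  obtain ⟨K, hK⟩ : ∃ K : ℝ, K = (13 * r + c) / (c - 2 * π * r) := ⟨_, rfl⟩
  have hK0 : 0 ≤ K := by rw [hK]; positivity
  have hKeq : K * (c - 2 * π * r) = 13 * r + c := by
    rw [hK, div_mul_cancel₀ _ hcr.ne']
  -- threshold height `T₀ = max H (2π · exp (14 + K))`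
  obtain ⟨t, t', hT₀t, htt', -, -, hfree, hc'le⟩ := hgap (max H (2 * π * Real.exp (14 + K)))
  have hHt : H ≤ t := (le_max_left _ _).trans hT₀t
  have hAt : 2 * π * Real.exp (14 + K) ≤ t := (le_max_right _ _).trans hT₀t
  have hexp : 15 + K ≤ Real.exp (14 + K) := by linarith [Real.add_one_le_exp (14 + K)]
  have hexp15 : (15 : ℝ) ≤ Real.exp (14 + K) := by linarith
  have h30 : 2 * π * 15 ≤ 2 * π * Real.exp (14 + K) :=
    mul_le_mul_of_nonneg_left hexp15 (by positivity)
  have ht10 : 10 ≤ t := by linarith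
  have ht0 : 0 < t := by linarith
  have hL : 14 + K ≤ Real.log (t / (2 * π)) := by
    have h1 : Real.exp (14 + K) ≤ t / (2 * π) := by
      rw [le_div_iff₀ (by positivity)]; linarith
    calc 14 + K = Real.log (Real.exp (14 + K)) := (Real.log_exp _).symm
      _ ≤ Real.log (t / (2 * π)) := Real.log_le_log (Real.exp_pos _) h1
  have hlogt : Real.log t = Real.log (t / (2 * π)) + Real.log (2 * π) := by
    rw [Real.log_div ht0.ne' (by positivity)]; ring
  have hlog2π := Literature.NumberTheory.LFunctions.LittlewoodAverage.log_two_pi_le_two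
  have hlog2π0 : 0 ≤ Real.log (2 * π) := Real.log_nonneg (by linarith)
  have hℓ0 : 0 < Real.log t := by rw [hlogt]; linarith
  -- the `θ'` floor `m`
  obtain ⟨m, hm⟩ : ∃ m : ℝ, m = Real.log (t / (2 * π)) / 2 - thetaDerivErr t := ⟨_, rfl⟩
  have herr : thetaDerivErr t ≤ 1 / 100 := thetaDerivErr_le_of_ten_le ht10
  have hm_ge : Real.log (t / (2 * π)) / 2 - 1 / 100 ≤ m := by rw [hm]; linarith
  have hm0 : 0 < m := by linarith
  -- the width at `t` and the step `d`
  have hwt : 0 < c / Real.log t := div_pos hc0 hℓ0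
  have hgap0 : 0 < t' - t := by linarith
  obtain ⟨d, hd⟩ : ∃ d : ℝ, d = min (2 * (c / Real.log t)) (9 / 10 * (t' - t)) := ⟨_, rfl⟩
  have hd0 : 0 < d := by rw [hd]; exact lt_min (by linarith) (by linarith)
  have hd2 : d ≤ 2 * (c / Real.log t) := by rw [hd]; exact min_le_left _ _
  have hdlt : d < t' - t := by rw [hd]; exact (min_le_right _ _).trans_lt (by linarith)
  have hN := count_eq_of_rhAbove_of_gap hRH hHt (u := t + d) (by linarith) (by linarith) hfree
  have hS : zetaArgS t - zetaArgS (t + d) =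
      (riemannSiegelTheta (t + d) - riemannSiegelTheta t) / π := by
    have := zetaArgS_sub t (t + d)
    rw [hN] at this
    linarith
  have hθ := theta_sub_ge (a := t) (b := t + d) (by linarith) (by linarith)
  rw [← hm, show t + d - t = d by ring] at hθ
  -- `m · d > 2πr`
  have hmd : 2 * π * r < m * d := by
    rcases le_total (2 * (c / Real.log t)) (9 / 10 * (t' - t)) with hcase | hcase
    · have hdeq : d = 2 * (c / Real.log t) := by rw [hd, min_eq_left hcase]
      rw [hdeq, show m * (2 * (c / Real.log t)) = 2 * (m * c) / Real.log t by ring,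
        lt_div_iff₀ hℓ0]
      -- `2πr · log t < 2 m c`
      have h1 : (Real.log (t / (2 * π)) / 2 - 1 / 100) * c ≤ m * c :=
        mul_le_mul_of_nonneg_right hm_ge hc0.le
      have h2 : (14 + K) * (c - 2 * π * r) ≤ Real.log (t / (2 * π)) * (c - 2 * π * r) :=
        mul_le_mul_of_nonneg_right hL hcr.le
      have h4 : π * r * Real.log (2 * π) ≤ π * r * 2 := mul_le_mul_of_nonneg_left hlog2π hπr.le
      have h5 : π * r < 3.15 * r := mul_lt_mul_of_pos_right hπ4 hr0
      have h6 : 3 * r < π * r := mul_lt_mul_of_pos_right hπ3 hr0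
      rw [hlogt]
      linarith only [h1, h2, hKeq, h4, h5, h6, hc, hr0]
    · have hdeq : d = 9 / 10 * (t' - t) := by rw [hd, min_eq_right hcase]
      have h1 : 2 * π * c' ≤ (t' - t) * Real.log t := by
        have := hc'le
        rw [le_div_iff₀ (by positivity)] at this
        linarith
      have hmc : 3 * m < m * c' := by nlinarith
      have hc'0 : 0 < c' := by linarith
      have h2 : Real.log t < 9 / 10 * m * c' := by
        rw [hlogt]
        linarith
      have h4 : (t' - t) * Real.log t < (t' - t) * (9 / 10 * m * c') :=
        mul_lt_mul_of_pos_left h2 hgap0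
      have h5 : 2 * π * c' < m * (9 / 10 * (t' - t)) * c' := by linarith
      have h6 : 2 * π < m * (9 / 10 * (t' - t)) := lt_of_mul_lt_mul_right h5 hc'0.le
      have h7 : 2 * π * r ≤ 2 * π * 1 := mul_le_mul_of_nonneg_left hr1 (by positivity)
      rw [hdeq]
      exact h7.trans_lt (by rw [mul_one]; exact h6)
  have hge : 2 * r < zetaArgS t - zetaArgS (t + d) := by
    rw [hS, lt_div_iff₀ Real.pi_pos]
    linarith
  have hℓd : 0 < Real.log (t + d) := Real.log_pos (by linarith)
  have hlt := (abs_lt.1 (abs_sub_lt_of_dyadicPinW' hB hHt (t₂ := t + d) (by linarith)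
    (by linarith) (div_pos hc0 hℓd).le)).2
  linarith

/-- Hence, riemannHypothesisUpTo_platt_trudgian-free and for every height: radius `0 < r ≤ 1`, width `c/log t` with `c > 2πr` is
REFUTED (the pin above `max H 2` supplies its own RH-above by §2). -/
theorem not_dyadicPinW_logWidth (hBM : buiMilinovich2018_theorem11_critical) {H c r : ℝ}
    (hr0 : 0 < r) (hr1 : r ≤ 1) (hc : 2 * π * r < c) :
    ¬ DyadicPinW H r fun t ↦ c / Real.log t := by
  intro hB
  have hB' : DyadicPinW (max H 2) r fun t ↦ c / Real.log t := hB.mono (le_max_left _ _) le_rfl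
  have h2 : (2 : ℝ) ≤ max H 2 := le_max_right _ _
  have hlogpos : ∀ t : ℝ, max H 2 ≤ t → 0 < Real.log t := fun t ht ↦ Real.log_pos (by linarith)
  have hc0 : 0 < c := by
    have : 0 < π * r := by positivity
    linarith
  have hRH : RHAbove (max H 2) :=
    rhAbove_of_dyadicPinW (by linarith) hr1
      (fun a ha b _ hab ↦ div_le_div_of_nonneg_left hc0.le (hlogpos a ha)
        (Real.log_le_log (by linarith [Set.mem_Ici.1 ha]) hab))
      (fun t ht ↦ div_pos hc0 (hlogpos t ht)) hB'
  exact not_dyadicPinW_logWidth_of_rhAbove hBM hr0 hr1 hc hRH hB'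

end Summit.RiemannHypothesis.RiemannHypothesis.Theorems.Splittings.ZdReferencePins

end
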